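import Mathlib.Tactic.Linarith
import Mathlib.Tactic.Ring
import Mathlib.Tactic.NormNum
import Mathlib.Tactic.FieldSimp
import Mathlib.Tactic.LinearCombination
import Mathlib.Tactic.Abel
import Mathlib.Algebra.GroupWithZero.Basic
import HarnessLib

/-!
# The (0,1) cell of the ι-window, EXISTENCE side, XIV: the 24 special pinching points and the end of the
# hypotheses — `ρ_ram = ∅` and (S) is a theorem — arithmetic / algebra skeleton of `H2-EXISTENCE-SIDE-14.md`

Family `hodge`, b2b cell `hweil`, `Summits/HodgeConjecture/HodgeConjecture/Theorems` (helper of item stmt-HodgeConjecture-2524, the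
Weil-sixfold rung the H2 test serves). Companion to `WeilTypeLadderH2W2CornerEight … Thirteen.lean` ([VIII]–[XIII]) with the SAME dictionary:
`X = J(C)`, `C` general of genus `4` on the smooth quadric `Q`, `ι = −1`, `Θ_n = W₃ − h`, `Θ_{−n} = W₃ − g`, `S = C − C`, the `j = 2` saturated
corner sheaf `F̂ = F̂_{z₁}` pinched along `Z₁ = z₁ − C`, its vertex module `M⁽²⁾ = Rf_u + Rf_v` (`R = k[[x,y,z,w]]`, `f_u` even of order `1`, `f_v` odd of
order `2`), the residual germ `R_u` (`div_S û = Γ₄ + R_u`), the plane `Λ = Π′ = cone(ℓ′)` with the quadratic forms `(a, b) = (κ, κ′)·m′m″` and the cubic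
`c₃|_Λ = λ′ m m′m″` ([X] 3.3, A.1), the relation ideal `B = {b : b f_v ∈ R f_u}` with linear part `k·ℓ_B`, `ℓ_B = κ′x − κz`, the rank-`2` bundle
`𝓥₁ = (F̂ ⊗ 𝒪_{Z₁})/tors` of degree `8` with its sub-line-bundles `K_v = ker(ev_v)` ([XI] 2.1), `K′ = K_{Ċ(z₁″)}`, `K″ = K_{Ċ(z₁′)}` (degree `4`), the
pencil (degree `3`), the `h`-family (degree `2`, containing `K₀`, `K_{σ₊}`), the (R0) rows `(k, δ, ℓ₀ = δ + 2k − 6)`, and — new here — the `24` SPECIAL `z₁`: the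
`12` ramification points `r` of `π_g` (`g_r = 2r + r″`) and their `12` co-points `r″`; at a co-point `K_Y := K_{Ċ(r)}` (degree `4`, `K_Y(0) = V₊`),
`𝓥₁ ≅ K_Y ⊗ F₂^{(e)}` with `[e] = φ_K(r)`, and the module `M_Y = F^Y_{K_Y,0} = Rg + Rh`. Report
`run/shared/lean/b2b/hodge-weil/b2b-hweil-pv3-g21/H2-EXISTENCE-SIDE-14.md` (LEMMAS 1.1–1.3 / THEOREM 1: [X] §3/§A at EVERY `z₁`; THEOREM 2: `ρ_ram = ∅`;
THEOREM 3: the splitting `𝓥₁ = K′ ⊕ K″` and the end of hypothesis (S); THEOREM 3′: the co-point structure; THEOREM 4: the colength-`4` census of `M_Y`),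
pv3-g20's NEXT list items (2)–(3); code `run/shared/lean/b2b/hodge-weil/code/pv3-g21/`. Def-free, fully proved ELEMENTARY statements (an identity in
an additive group, a zero-divisor step, linear algebra of a `2 × 1` system, dimension counts, degree bookkeeping, the case list of a finite census);
the sheaf theory is in the docstrings and the report. HONEST FRAMING: structure / census results about one cell of the ladder's H2 test on the
existence side, on the Jacobian locus only; no case of the Hodge conjecture is proved; nothing here is a rung; no statement of [Markman 2025] is
used; nothing here depends on (LP), (8.3.3), 'ker ob = ann(ch)', (GP17), (GP18) or (S).

§1 the three lemmas (`divisor_identity_Ru`, `ab_from_quartic_identity`, `linB_dimension_le_one`, `cubic_window_dimension`); §2 the special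
carriers (`ell0_at_special_points`); §3 the splitting (`splitting_degrees`); §4 the co-points (`copoint_census`); §5 THEOREM 4
(`colength_four_census_MY`).

What is NOT here: sheaves, `𝓥₁`, `F₂`, the modules, the Ext groups, the families. 0 unconditional rungs above the floor.
-/

set_option linter.dupNamespace false

namespace Summit.HodgeConjecture.HodgeConjecture.WeilTypeLadder

section H2W2CornerFourteen

/-- LEMMA 1.1 (report): `R_u` is ι-invariant at EVERY `z₁`. For the T-fixed generator `û` of `N₁ = 𝓘_{Γ₄} = 𝒪_S(−Γ₄)` the gluing
`ψ = (û^ι/û)·` maps `𝒪_S(−Γ₄)` onto `N₂ = 𝒪_S(−ιΓ₄)`; on a normal surface germ `φ·𝒪_S(−E) = 𝒪_S(−E − div φ)` and reflexive rank-one ideals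
determine their Weil divisors, so `Γ₄ + div φ = ιΓ₄`; with `div û = Γ₄ + R_u`, `div û^ι = ιΓ₄ + ιR_u`, `div φ = (ιΓ₄ + ιR_u) − (Γ₄ + R_u)`, this forces
`ιR_u = R_u` as divisors — with no hypothesis on `z₁` (replacing [X] 3.2 (d)'s branch argument, which needed `z₁ ∉ Ram(π_g)`). Recorded: the
cancellation in any additive commutative group (divisors): if `d = (ιΓ + ιR) − (Γ + R)` and `d = ιΓ − Γ` then `ιR = R`. [§1.1] -/
theorem divisor_identity_Ru :
    ∀ {A : Type} [AddCommGroup A] (Γ ιΓ R ιR d : A),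
      d = (ιΓ + ιR) - (Γ + R) → d = ιΓ - Γ → ιR = R := by
  intro A _ Γ ιΓ R ιR d h1 h2
  have h3 : (ιΓ + ιR) - (Γ + R) = ιΓ - Γ := h1 ▸ h2
  have h4 : ιR - R = ((ιΓ + ιR) - (Γ + R)) - (ιΓ - Γ) := by abel
  rw [h3, sub_self] at h4
  exact sub_eq_zero.mp h4

/-- LEMMA 1.2 (report): `(a, b)` explicitly, at EVERY `z₁`. Restricting [X] A.2 (c)'s congruence of quartic forms
`a₄ = x·v₃ − mw·ũ₂ ≡ −c₃·(γ₁(0)x + γ₂(0)w) (mod q)` to the plane `Λ = {x = z = 0}` (where `x` and `q` vanish) gives `m·w·a = γ₂(0)·w·c₃|_Λ`, and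
`c₃|_Λ = λ′·m·m′·m″` ([X] A.1); in the domain `k[y,w]`, `m ≠ 0` (and `w ≠ 0`) give `a = γ₂(0)λ′·m′m″`. Then [X] A.1's `ya − wb = λ′mm′m″`, with
`m = w₁y − y₁w` and `w ∤ m′m″` (`p` general), reads `w·b = λ′m′m″((γ₂(0) − w₁)y + y₁w)`, so `w ∣ (γ₂(0) − w₁)y + y₁w`, i.e. `(γ₂(0) − w₁)y + y₁w = c·w`
identically, whence (at `y = 1, w = 0`) `γ₂(0) = w₁`, `b = λ′y₁m′m″`: `(a,b) = λ′(w₁, y₁)·m′m″`, `κ = λ′w₁ ≠ 0` ([X] 3.3's conclusion without its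
hypothesis). Recorded: the zero-divisor step in a ring without zero-divisors, and the linear-algebra step `γ = w₁`. [§1.2] -/
theorem ab_from_quartic_identity :
    (∀ {R : Type} [CommRing R] [NoZeroDivisors R] (m a γ lam mp mpp : R),
      m ≠ 0 → m * a = γ * (lam * (m * (mp * mpp))) → a = γ * lam * (mp * mpp)) ∧
    (∀ γ w1 y1 : ℚ, (∃ c : ℚ, ∀ y w : ℚ, (γ - w1) * y + y1 * w = c * w) → γ = w1) := by
  refine ⟨?_, ?_⟩
  · intro R _ _ m a γ lam mp mpp hm h
    have h' : m * (a - γ * lam * (mp * mpp)) = 0 := by linear_combination h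
    rcases mul_eq_zero.mp h' with h1 | h2
    · exact absurd h1 hm
    · exact sub_eq_zero.mp h2
  · rintro γ w1 y1 ⟨c, hc⟩
    have h := hc 1 0
    linarith

/-- LEMMA 1.3 (a) (report): `lin(I_{Π′} ∩ I_{ιΠ′}) ⊂ k·ℓ_B` is a LINE at every `z₁`. An element `Aũ + Bz′` of `I_{Π′}` with linear part `αx + βz`
restricts on `ιΠ′` (parametrised by `(y,w)`: `ũ| = 2a + O(3)`, `z′| = 2b + O(3)`) to `2(αa + βb) + O(3)`, so membership in `I_{ιΠ′}` needs
`αa + βb = 0`; with `(a, b) = (κ, κ′)·n`, `n = m′m″ ≠ 0` (1.2; [X] A.1: `(a,b) ≠ (0,0)` because `ya − wb = c₃|_Λ ≠ 0`), this is `(ακ + βκ′)·n = 0`,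
i.e. `ακ + βκ′ = 0`, whose solutions form the line `k·(κ′, −κ)` (here `κ ≠ 0`): `lin = k·ℓ_B`, `ℓ_B = κ′x − κz` — the bound [X] A.4 (c) stated under
'z₁ unramified', now unconditional, and EQUALITY by [X] A.3 (c)'s syzygy. So [X] A.5 (ii) (type II₊) holds verbatim at every `z₁`, and W-P3g17-A5-a's
bracket is void. Recorded: the reduction `(αa + βb = 0, (a,b) = (κ,κ′)n, n ≠ 0) ⇒ ακ + βκ′ = 0` and the parametrisation of its solution line.
[§1.3 (a), THEOREM 1] -/
theorem linB_dimension_le_one :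
    (∀ κ κ' α β n : ℚ, n ≠ 0 → α * (κ * n) + β * (κ' * n) = 0 → α * κ + β * κ' = 0) ∧
    (∀ κ κ' α β : ℚ, κ ≠ 0 → (α * κ + β * κ' = 0 ↔ α = -(κ' / κ) * β)) ∧
    (∀ κ κ' t : ℚ, (t * κ') * κ + (t * (-κ)) * κ' = 0) := by
  refine ⟨?_, ?_, ?_⟩
  · intro κ κ' α β n hn h
    have h' : (α * κ + β * κ') * n = 0 := by linear_combination h
    rcases mul_eq_zero.mp h' with h1 | h2
    · exact h1
    · exact absurd h2 hn
  · intro κ κ' α β hκ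
    constructor
    · intro h
      field_simp
      linarith
    · intro h
      subst h
      field_simp
      ring
  · intro κ κ' t; ring

/-- LEMMA 1.3 (b) + its degree-2 case (report): the low-degree windows of `J = I_{Π′} ∩ I_{ιΠ′}`. Degree 2: `in(J)₂ ⊂ ℓ_B·S₁ + k·ℓ₀²`, of
dimension `4 + 1 = 5` (`= dim (x,z)·S₁ + … = 3 + 4 − 2`, the five quadratic leading forms of `B` seen by the machine at every `z₁`). Degree 3:
`in(J)₃ ⊂ (x,z)²·S₁ + ℓ_B·S₂ = (ℓ_B, ℓ₀²)₃`, of dimension `10 + 4 − 1 = 13 = 10 + 10 − 7` (`ℓ_B·S₂` has dimension `10`, `ℓ₀²·S₁` has `4`, they meet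
in `k·ℓ_Bℓ₀²`; equivalently `(x,z)²S₁` (`10`) `+ ℓ_BS₂` (`10`) meeting in `ℓ_B·(x,z)·S₁` (`7`)) — inside `in((x,z))₃` of dimension
`10 + 10 − 4 = 16`; the machine's `13` cubic leading forms of `B`. Consequence (5.2 (d)): an even `c ∈ B_h` of order `2` has `c₂·ℓ₂ ∈ (ℓ_B, ℓ₀²)₃` with
`ℓ₂` a non-zero-divisor modulo the `(ℓ_B,ℓ₀)`-primary ideal `(ℓ_B, ℓ₀²)`, so `c₂ ∈ ℓ_BS₁ + kℓ₀²`: `B_h` has exactly ONE even order-`2` class. Recorded: the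
dimension counts. [§1.3 (b), §5.2 (d)] -/
theorem cubic_window_dimension :
    ((4 : ℕ) + 1 = 5 ∧ (3 : ℕ) + 4 - 2 = 5) ∧
    ((10 : ℕ) + 4 - 1 = 13 ∧ (10 : ℕ) + 10 - 7 = 13 ∧ (10 : ℕ) + 10 - 4 = 16 ∧ (13 : ℕ) < 16) ∧
    ((5 : ℕ) - 4 = 1) := by
  refine ⟨by norm_num, by norm_num, by norm_num⟩

/-- PROPOSITION 2.2 + THEOREM 2 (report): the carriers `A⁻_{r+q}` at the `24` special `z₁`. With `x_{A⁻} = 3` and the deficit formula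
`ℓ₀ = 2x_A + 2e_A + r − 6` ([X] 2.4): at `z₁ = r` (ramification point of `π_g`, `D′ = r + q`) the pinching point `A ∩ Z₁ = {r − q}` IS the gluing
point, `A ⋔ Θ_{−n}` there (`T_yΘ_{−n} = cone⟨r, ℓ^g_q⟩ ∌ Ċ(r″)`), so `r_y = min(i_y, m_y − e_y) = min(1, 1 − 1) = 0`, `r = 0`, `e_A = 1`,
`ℓ₀ = 2·3 + 2·1 + 0 − 6 = 2` — THEOREM 3.6 (colength `2`) kills it; at the co-point `z₁ = r″` the gluing orbit is off `Z₁ ∪ Z₂`, `r = 2`, `e_A = 1`,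
`ℓ₀ = 2·3 + 2·1 + 2 − 6 = 4` — THEOREM A.5 (colength `4`, valid there by THEOREM 1) kills it. So E-P3g20-1's residual `ρ_ram` — `24 × 11 = 264`
carrier configurations — splits as `12·11 = 132` of colength `2` plus `132` of colength `4`, all dead: `ρ_ram = ∅`. (ERRATUM E-P3g21-1 to [XIII] B.1 (d):
'`(e,r) = (1,2), ℓ₀ = 4`' holds at `r″`, but at `r` it is `(1,0), ℓ₀ = 2`.) [§2.2–2.3] -/
theorem ell0_at_special_points :
    (min (1 : ℕ) (1 - 1) = 0 ∧ min (1 : ℕ) 1 = 1) ∧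
    ((2 : ℤ) * 3 + 2 * 1 + 0 - 6 = 2 ∧ (2 : ℤ) * 3 + 2 * 1 + 2 - 6 = 4) ∧
    ((24 : ℕ) * 11 = 264 ∧ (12 : ℕ) * 11 = 132 ∧ (132 : ℕ) + 132 = 264) := by
  refine ⟨by norm_num, by norm_num, by norm_num⟩

/-- THEOREM 3 + COROLLARIES 3.4–3.5 (report): the SPLITTING. For `z₁′ ≠ z₁″` the degree-`8` bundle `𝓥₁` contains the two distinct saturated
sub-line-bundles `K′ = K_{Ċ(z₁″)}`, `K″ = K_{Ċ(z₁′)}` of degree `4` ([XI] 2.1–2.2: `deg K_v = Σ_y m_v(y) = 2 + #{c : Ċ(c) ∈ kv} + m_v(0)`, `= 2 + 1 + 1`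
for `[v] ∈ {z₁′, z₁″}`, `= 2 + 0 + 1 = 3` otherwise; at `z₁ = r`, `deg K_ζ = 2 + 0 + m_ζ(0)` with `m_ζ(0) ≥ 2` and `deg K_ζ + 4 ≤ 8`, so `= 4`), hence
`K′ ⊕ K″ → 𝓥₁` is injective of equal rank and degree `4 + 4 = 8`: an isomorphism. One degree-`3` subbundle forces `K′K″⁻¹ ≅ 𝒪(y″ − y′)` (degree `0`);
the saturated sub-line-bundles of degree `≥ 2` are exactly `K′, K″` (`4`), the pencil `≅ K′(−y″)` (`4 − 1 = 3`, one `k*`), the `h`-family `≅ K′(−E′)`,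
`E′ = h_{z₁′} − z₁′` (`4 − 2 = 2`, one `k*`, meeting `V₋`, `V₊` once each: `K₀`, `K_{σ₊}`), and NOTHING of degree `≥ 5` (a sub-line-bundle of `K′ ⊕ K″`
has degree `≤ 4`; equivalently `k + 4 ≤ 8`). So hypothesis (S) of [XI] 2.6 HOLDS and the (R0) table `ℓ₀ = δ + 2k − 6` over `(k, δ) ∈ {2,3,4} × {0,2}`
— values `−2, 0, 0, 2, 2, 4` — is complete. Recorded: the degree bookkeeping. [§3] -/
theorem splitting_degrees :
    ((2 : ℕ) + 1 + 1 = 4 ∧ (2 : ℕ) + 0 + 1 = 3 ∧ (4 : ℕ) + 4 = 8 ∧ (4 : ℤ) - 4 = 0 ∧ (4 : ℕ) - 1 = 3 ∧ (4 : ℕ) - 2 = 2) ∧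
    (∀ d : ℕ, 4 ≤ d → d + 4 ≤ 8 → d = 4) ∧
    (∀ k : ℕ, 5 ≤ k → ¬ (k + 4 ≤ 8)) ∧
    ((2 : ℤ) + 2 * 2 - 6 = 0 ∧ (0 : ℤ) + 2 * 2 - 6 = -2 ∧ (0 : ℤ) + 2 * 3 - 6 = 0 ∧ (2 : ℤ) + 2 * 3 - 6 = 2 ∧
     (0 : ℤ) + 2 * 4 - 6 = 2 ∧ (2 : ℤ) + 2 * 4 - 6 = 4) := by
  refine ⟨by norm_num, ?_, ?_, by norm_num⟩
  · intro d h1 h2; omega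
  · intro k hk h; omega

/-- THEOREM 3′ + COROLLARY 4.3–4.4 (report): the CO-POINTS `z₁ = r″` (`z₁′ = z₁″ = r`). Here only ONE `K_v` has degree `4` — `K_Y := K_{Ċ(r)}`,
`deg = 2 + 1 + 1` (the off-vertex point `y′ = r″ − r` and the vertex), all others `2 + 0 + 1 = 3` — and `K_Y(0) = V₊` (`B₂(Ċ(r), z₁) = κm′(r)² = 0`);
`𝓥₁` is NOT split (a second degree-`4` subbundle would force a `g¹₁`), and the non-split extension `0 → K_Y → 𝓥₁ → Q → 0` has `Q ≅ K_Y`: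
`𝓥₁ ≅ K_Y ⊗ F₂^{(e)}`, `[e] = φ_K(c₀)` with `c₀ = r`. Census (4.1: a lift of `𝒪(−D) → 𝒪` to `F₂^{(e)}` exists iff `e ∈ ⟨D⟩`, is unique up to the
`h⁰(𝒪(D)) = 1`-dimensional torsor, and is saturated iff all `α_x ≠ 0`): degree `3` = lifts of `K_Y(−r)`, an `𝔸¹` of dimension `h⁰(𝒪(r)) = 1`
(`h⁰(F₂(r)) = 1 + 1 = 2` sections), containing `K_S`; degree `2` = lifts of `K_Y(−r₁ − r₂)` (`h_r = r + r₁ + r₂`: the trisecant through `φ_K(r)`;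
`deg = 4 − 2`), an `𝔸¹` containing `K₀` — the `g`-option `D = r + r″` has `α_{r″} = 0` and is not saturated; NO `V₊`-member in degrees `2, 3`. New (R0)
row at a co-point: `(k, δ, ℓ₀) = (4, 2, 2 + 8 − 6 = 4)` over `K_Y` — colength-`4` vertex junk in `M_Y`, killed by THEOREM 4. Recorded: the counts.
[§4] -/
theorem copoint_census :
    ((2 : ℕ) + 1 + 1 = 4 ∧ (2 : ℕ) + 0 + 1 = 3 ∧ (4 : ℕ) ≠ 3) ∧
    ((1 : ℕ) + 1 = 2 ∧ (4 : ℕ) - 1 = 3 ∧ (4 : ℕ) - 2 = 2 ∧ (2 : ℕ) + 1 = 3) ∧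
    ((2 : ℤ) + 2 * 4 - 6 = 4 ∧ (0 : ℤ) + 2 * 2 - 6 < 0) := by
  refine ⟨by norm_num, by norm_num, by norm_num⟩

/-- THEOREM 4 (report, §5): the colength-`4` census of `M_Y = F^Y_{K_Y,0} = Rg + Rh` (`g = f_u + b·f_v` EVEN of order `1`, `h = ℓ̃₂f_v` EVEN of
order `3`; `V(M_Y) = k₊²`, `U = 𝔪M_Y/𝔪²M_Y = k₋^u`, `u ≥ 3` — machine `u = 7`; `A_g ⊂ 𝔪³`; `lin B_h = kℓ_B` with one even order-`2` class). A balanced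
(`(2,2)`) ι-stable colength-`4` quotient `T` has top `⊂ V = k₊²`, hence is of type (α) top `= V`, layers `(2; 2)` (signs `(++; −−)`); or cyclic on an
even generator with Hilbert function `(1,2,1)` [II₊, layers `(+;−−;+)`] or `(1,1,1,1)` [I₊, `(+;−;+;−)`] — `(1,3)` is unbalanced (`1 + 0 ≠ 0 + 3`… signs
`(1,3)`), `(2,1,1)` is unbalanced (`2 + 1 = 3 ≠ 1`). Lower bounds for `tan = hom^ι(N′, T)`: (α) the submodules are `W + 𝔪²M_Y`, `W ⊂ U` of codimension
`2`, a Grassmannian of dimension `2(u − 2) ≥ 2`; CASE A (cyclic on `ḡ`), II₊: socle map `+` quadric-generator maps with `≤ 1` condition: `1 + (2 − 1) = 2`;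
CASE A, I₊: odd-generator maps, `3 − 1 = 2`; CASE B (cyclic on `h̄`, `g − rh ∈ N′`), II₊: `A_g ⊂ 𝔪³` makes every even `t ∈ T₊ = kτ ⊕ 𝔪²T` a target:
`1 + 1 = 2`; CASE B, I₊: `1 + (3 − 1) = 3`. Minimum `2`: every balanced colength-`4` `N′ ⊂ M_Y` has `tan ≥ 2`, so (QT) kills row `(4,2,4)` at the `12`
co-points. Recorded: the sign sums of the type list and the five lower bounds. [§5.3–5.4] -/
theorem colength_four_census_MY :
    ((2 : ℕ) + 0 = 0 + 2 ∧ (1 : ℕ) + 1 = 2 + 0 ∧ (1 : ℕ) + 1 = 1 + 1 ∧ (1 : ℕ) + 0 ≠ 0 + 3 ∧ (2 : ℕ) + 1 ≠ 1) ∧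
    (∀ u : ℕ, 3 ≤ u → 2 ≤ 2 * (u - 2)) ∧
    ((1 : ℕ) + (2 - 1) = 2 ∧ (3 : ℕ) - 1 = 2 ∧ (1 : ℕ) + 1 = 2 ∧ (1 : ℕ) + (3 - 1) = 3) ∧
    (∀ t : ℕ, t ∈ [2 * (7 - 2), 2, 2, 2, 3] → 2 ≤ t) := by
  refine ⟨by norm_num, ?_, by norm_num, ?_⟩
  · intro u hu; omega
  · intro t ht
    simp only [List.mem_cons, List.not_mem_nil, or_false] at ht
    rcases ht with h | h | h | h | h <;> omega

end H2W2CornerFourteen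

section H2W2CornerFourteenJunkRows

/-- LEMMA 5.6 + PROPOSITION 5.7 + THEOREM 5 (report §5.6–5.8): the colength-`2` JUNK ROWS, pen-and-paper. For a finitely generated ι-module `M`
(all finite-colength submodules non-cyclic) and a balanced curvilinear colength-`2` quotient `T = M/N′` with top of sign `s`: writing
`N′ = Σ_k R·(g_k − r_k g₀) + 𝔞·g₀` on a minimal homogeneous generating set, the maps `g_k − r_k g₀ ↦ soc T` for the generators `g_k` of sign `−s` are
well defined (a relation with a unit coefficient would contradict minimality) and ι-equivariant: `tan ≥ dim V_{−s}`; and the socle maps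
`a·g₀ ↦ ψ̄(ā)·soc` on the three odd linear generators of `𝔞 = (v^⊥) + 𝔪²` are constrained only by the `g₀`-components of the linear syzygies among
the sign-`s` generators: `tan ≥ dim V_{−s} + (3 − r)`, `r ≤ dim LS^{[V_s]}`. The junk modules (5.7): `δ = 0` (`K(0)` generic; rows `(4,0,2)`):
`M_K ⊂ 𝔪M⁽²⁾` with `dim V₋ ≥ 3` (the images `ℓ ⊗ f̄_u`, `ℓ ∈ ζ^⊥`) and `dim V₊ ≥ 2` (the images `λ ⊗ f̄_v`, `λ ∈ ζ^⊥/kℓ_B`, dimension `3 − 1`);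
`K_S`-type (`K(0) = V₋`; row `(3,2,2)`): `dim V₋ ≥ 3`, `dim LS^{[V₋]} ≤ 1`; `K_{v₊}`/`K_Y`-type (`K(0) = V₊`): `V = k₊²`, `dim LS^{[V₊]} ≤ 1`. THEOREM 5: every
balanced colength-`2` `N′` in a junk module has `tan ≥ 2` — `M_K`: top odd `≥ 2`, top even `≥ 3`, semisimple `μ ≥ 2`; `M_S`: top odd `≥ 0 + (3 − 1)`, top even
`≥ 3`; `M_Y`-type: top even (the only case) `≥ 0 + (3 − 1) = 2` — at EVERY `z₁ ∉ Ram(π_h)`, replacing the machine-faithful label of [XI] §4's rows and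
covering `z₁ = r` and the co-points. Recorded: the five counts and their minimum. [§5.6–5.8] -/
theorem junk_rows_colength_two :
    ((3 : ℕ) - 1 = 2 ∧ (3 : ℕ) ≥ 2 ∧ (2 : ℕ) ≥ 2) ∧
    (∀ dVm dVp r : ℕ, 3 ≤ dVm → 2 ≤ dVp → r ≤ 1 → (2 ≤ dVp ∧ 2 ≤ dVm ∧ 2 ≤ dVp + (3 - r))) ∧
    (∀ r : ℕ, r ≤ 1 → 2 ≤ 0 + (3 - r)) ∧
    (∀ t : ℕ, t ∈ [2, 3, 2, 2, 3, 2] → 2 ≤ t) := by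
  refine ⟨by norm_num, ?_, ?_, ?_⟩
  · intro dVm dVp r h1 h2 h3
    refine ⟨h2, by omega, by omega⟩
  · intro r hr; omega
  · intro t ht
    simp only [List.mem_cons, List.not_mem_nil, or_false] at ht
    rcases ht with h | h | h | h | h | h <;> omega

end H2W2CornerFourteenJunkRows

end Summit.HodgeConjecture.HodgeConjecture.WeilTypeLadder
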